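/-
Copyright (c) 2026 the pub-hodgecm-mathlib formalisation cell (harness21).  Prover seat hodgecm-mathlib-K2-defs1 (g6), Track B, h413 = `stmt-HodgeConjecture-24833`, route `HCCMUnconditional`,
campaign «5Res (b) BL-2(χ,τ)», SHEET row 12d-C (dealer K2E1-plan (g7) (140) 2026-09-04T11:34:53Z).
-/
import Summits.HodgeConjecture.HodgeConjecture.Theorems.K2E1EquivariantSectionLine          -- 📤 12d-I (this seat): the LINE + one-scalar mechanism
import Summits.HodgeConjecture.HodgeConjecture.Theorems.K2E1ChiEisensteinSolvesXSystemU2   -- ★ row 11 (this seat): `flatSectionU_mul_of_mem_comap`; brings rows 9∕3, ★ p859441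
import Literature.NumberTheory.Automorphic.UnitaryGroupIwasawaAdelic                       -- ★ `exists_upper_mul_mem_Kinf` (arch Iwasawa), `ofInfinite_mem_standardParabolicGL`, `map_Kinf_le_standardMaximalCompactGL`
import Literature.NumberTheory.Automorphic.UnitaryGroupAdelicProductHaar                   -- ★ `exists_integral_eq_smul_integral_adelicProdEquiv` (`∫_G = κ ∫_{G_∞ × G_f}`)
import HarnessLib

/-!
# 5Res (b) row 12d-C — `K2E1ChiHeckeArchScalarU2`: AN ARCHIMEDEAN-ONLY `K`-CENTRAL TEST FUNCTION `h = h_∞ ⊗ 𝟙_U` ACTS ON THE (χ,τ)-SECTION SPACE `V(χ, K′, ω)` BY A SCALAR —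
# `T_{h,z} φ = s(z) • φ` for all `φ ∈ V` (so the Hecke MATRIX of ★ row 10 is `𝔥(z) = s(z)·1`, the letter of ★ 12c)

Cell `pub/hodgecm-mathlib`, crux H413 = `stmt-HodgeConjecture-24833`.  THEOREMS ONLY (no `def`, no `instance`, no notation, no named-fact hypothesis, no `sorry`); lane `--supports
stmt-HodgeConjecture-24833 --as helper` (count-neutral).  Closes no socket.  Generic quadratic datum `(F, E, c)` with `c ≠ 1` fixing every infinite place, every rank `N`.

THE MATHEMATICS ([BernsteinLapid2019, §4 Claim 1]; [Knapp1986, VII §1]; [BorelJacquet1979, §4.1]).  `G(𝔸) = G_∞·G_f` with commuting factors (★ `UnitaryGroupAdelicProduct`), `ι = archToAdelic`,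
`ι_f = finAdelicToAdelic`.  §0: `G_∞ = B_∞·K_∞` in the COMAP spelling — `B_∞ := ι⁻¹B(𝔸)`, `K_∞ := ι⁻¹K` (★ arch Iwasawa `exists_upper_mul_mem_Kinf`).  §1: for a `χ`-section `φ ∈ V(χ,K′,ω)` with
`K′ ⊇ ι(K_∞)` and `K′ ≤ K`, and a finite-adelic `x_f`, the SLICE `a ↦ f_z^φ(ι(a)·x_f)` is a `(B_∞, c_z; K_∞, ω∘ι)`-section on `G_∞` (`c_z(b) = χ(b₀₀)(‖b₁₁‖⁻¹)^z`; `ι(k)` commutes with `x_f`).  §2: by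
📤 12d-I a `K_∞`-CENTRAL `h_∞` acts on all slices by ONE scalar `ĥ_∞(z)`; with ★ `exists_integral_eq_smul_integral_adelicProdEquiv` + Fubini `integral_prod_mul` and the right-`U`-invariance of
`f_z^φ` (`ι_f(U) ⊆ K′`, `ω = 1` there), `T_{h,z}φ(x) = (∫_G h(y)f_z^φ(xy)dy)·H(x)^{−z} = κ·μ_f(U)·ĥ_∞(z)·φ(x)` for the pure tensor `h(y) = h_∞(y_∞)·𝟙_U(y_f)`.  HEAD §3: `∃ s, ∀ φ ∈ V, T_{h,z}φ = s • φ`.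
The non-constancy of `z ↦ s(z)` (★ 12c's `hnc`) is NOT proved here (letter; see the docstring of the head).
* §0 `exists_mem_comap_borel_mul_mem_comap_K_arch`.  * §1 `slice_section`.  * §2 `exists_integral_pureTensor_mul_flatSectionU_eq`.  * §3 HEAD **`exists_rightConvSection_eq_smul_of_arch`**.
HONEST LABEL: HC_CM is proved only modulo the 7 printed citations (2 remaining named inputs: hLiu418 = `stmt-HodgeConjecture-24832`, h413 = `stmt-HodgeConjecture-24833`) until rung 0
closes; count-neutral helper, closes no socket.

## References
* [BernsteinLapid2019] J. Bernstein, E. Lapid, *On the meromorphic continuation of Eisenstein series*, J. Amer. Math. Soc. 37 (2024) (arXiv:1911.02342), §4 Claim 1.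
* [Knapp1986] A. W. Knapp, *Representation Theory of Semisimple Groups* (1986), VII §1.
* [BorelJacquet1979] A. Borel, H. Jacquet, *Automorphic forms and automorphic representations*, Proc. Symp. Pure Math. 33.1 (1979), §4.1.
-/

set_option autoImplicit false
-- the mandated namespace repeats the single-problem summit's segment (`HodgeConjecture.HodgeConjecture`)
set_option linter.dupNamespace false

noncomputable section

open MeasureTheory Measure NumberField IsDedekindDomain NumberField.InfinitePlace NumberField.mixedEmbedding
open scoped NNReal MatrixGroups Classical
open Literature.NumberTheory.Automorphic Literature.NumberTheory.Automorphic.UnitaryGroup AdelicGroupData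
open Literature.NumberTheory.GaloisRepresentations (HeckeCharacter)
open Summit.HodgeConjecture.HodgeConjecture.Cruxes.H413.K2E1BorelEisensteinU
open Summit.HodgeConjecture.HodgeConjecture.Cruxes.H413.K2E1CharacterEisensteinU2Defs
open Summit.HodgeConjecture.HodgeConjecture.Cruxes.H413.K2E1ChiSectionSpaceU2Defs
open Summit.HodgeConjecture.HodgeConjecture.Cruxes.H413.K2E1ChiEisensteinSolvesXSystemU2 (flatSectionU_mul_of_mem_comap)
open Summit.HodgeConjecture.HodgeConjecture.Cruxes.H413.K2E1EquivariantSectionLine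

namespace Summit.HodgeConjecture.HodgeConjecture.Cruxes.H413.K2E1ChiHeckeArchScalarU2

variable {F E : Type} [Field F] [NumberField F] [Field E] [NumberField E] [Algebra F E] {c : E ≃ₐ[F] E} {N : ℕ} [NeZero N]

/-! ## §0 `G_∞ = B_∞·K_∞` in the comap spelling -/

omit [NeZero N] in
/-- **ARCHIMEDEAN IWASAWA, COMAP SPELLING**: every `a ∈ G_∞ = U(J_N)(E ⊗ ℝ)` is `b k` with `ι(b) ∈ B(𝔸_F)` and `adelicVal (ι k) ∈ K` (`ι = archToAdelic`; ★ `exists_upper_mul_mem_Kinf` with the genuine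
archimedean decomposition ★ `exists_upper_mul_unitary`, transported by ★ `ofInfinite_mem_standardParabolicGL` ∕ ★ `map_Kinf_le_standardMaximalCompactGL`). [cite: BorelJacquet1979, §4.1] -/
theorem exists_mem_comap_borel_mul_mem_comap_K_arch (hc : c ≠ 1) (hfix : ∀ w : InfinitePlace E, c • w = w)
    (a : arch F E c N ((StdForm.antidiagonal N).over E)) :
    ∃ b ∈ (borelAdelic F E c N).comap (archToAdelic F E c N ((StdForm.antidiagonal N).over E)),
      ∃ k ∈ (((standardMaximalCompactGL N E).comap (adelicVal F E c N ((StdForm.antidiagonal N).over E))).comap (archToAdelic F E c N ((StdForm.antidiagonal N).over E))),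
        a = b * k := by
  obtain ⟨b, k, hb, hk, h⟩ := exists_upper_mul_mem_Kinf c hc hfix (fun g => UnitaryGroup.exists_upper_mul_unitary g) a
  refine ⟨b, ?_, k, ?_, h⟩
  · exact Subgroup.mem_comap.2 ((mem_standardParabolicGL_iff _ _).1 (ofInfinite_mem_standardParabolicGL N E hb))
  · exact Subgroup.mem_comap.2 (Subgroup.mem_comap.2 (map_Kinf_le_standardMaximalCompactGL (Subgroup.mem_map_of_mem _ hk)))

/-! ## §1 Slices of flat sections along the finite-adelic factor are archimedean sections -/

section Slices

variable {χ : HeckeCharacter E} {K' : Subgroup (quasiSplit F E c N).Adelic} {ω : ↥K' → ℂ}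

/-- **SLICES ARE ARCHIMEDEAN SECTIONS**: for `φ ∈ V(χ, K′, ω)` with `K′ ≤ K` and `K′ ⊇ ι(K_∞)` (`ι = archToAdelic`), every `z` and every finite-adelic `x_f`, the slice `a ↦ f_z^φ(ι(a)·ι_f(x_f))` on
`G_∞` is a `(B_∞, c_z; K_∞, ω∘ι)`-section in the sense of 📤 12d-I: `c_z(b) = χ(b₀₀)(‖b₁₁‖⁻¹)^z` (★ `flatSectionU_borel_mul_of_isChiSection`) and, since `ι(k)` commutes with `ι_f(x_f)` (★
`commute_archToAdelic_finAdelicToAdelic`), `f_z^φ(ι(a k)ι_f x_f) = f_z^φ(ι(a)ι_f(x_f)·ι(k)) = ω(ι k)·f_z^φ(ι(a)ι_f x_f)` (★ row 11 `flatSectionU_mul_of_mem_comap`). [cite: Knapp1986, VII §1] [cite: BorelJacquet1979, §4.1] -/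
theorem slice_section
    (hK' : K' ≤ ((standardMaximalCompactGL N E).comap (adelicVal F E c N ((StdForm.antidiagonal N).over E)) : Subgroup (quasiSplit F E c N).Adelic))
    (hKinf : ∀ k : arch F E c N ((StdForm.antidiagonal N).over E),
      adelicVal F E c N ((StdForm.antidiagonal N).over E) (archToAdelic F E c N _ k) ∈ standardMaximalCompactGL N E → archToAdelic F E c N _ k ∈ K')
    {φ : (quasiSplit F E c N).Adelic → ℂ} (hφ : φ ∈ chiSectionSpace χ K' ω) (z : ℂ) (xf : finAdelic F E c N ((StdForm.antidiagonal N).over E)) :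
    (∀ b ∈ (borelAdelic F E c N).comap (archToAdelic F E c N ((StdForm.antidiagonal N).over E)), ∀ a,
      (fun a => flatSectionU φ z (archToAdelic F E c N _ a * finAdelicToAdelic F E c N _ xf)) (b * a) =
        (fun b => if hb : archToAdelic F E c N ((StdForm.antidiagonal N).over E) b ∈ borelAdelic F E c N then
          ((χ (firstEntryUnit hb) : ℂˣ) : ℂ) * ((((IdeleClassGroup.ideleNorm E (lastEntryUnit hb))⁻¹ : ℝ≥0) : ℝ) : ℂ) ^ z else 0) b *
        (fun a => flatSectionU φ z (archToAdelic F E c N _ a * finAdelicToAdelic F E c N _ xf)) a) ∧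
    (∀ k ∈ (((standardMaximalCompactGL N E).comap (adelicVal F E c N ((StdForm.antidiagonal N).over E))).comap (archToAdelic F E c N ((StdForm.antidiagonal N).over E))), ∀ a,
      (fun a => flatSectionU φ z (archToAdelic F E c N _ a * finAdelicToAdelic F E c N _ xf)) (a * k) =
        (fun k => if hk : archToAdelic F E c N ((StdForm.antidiagonal N).over E) k ∈ K' then ω ⟨_, hk⟩ else 0) k *
        (fun a => flatSectionU φ z (archToAdelic F E c N _ a * finAdelicToAdelic F E c N _ xf)) a) := by
  refine ⟨fun b hb a => ?_, fun k hk a => ?_⟩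
  · have hb' : archToAdelic F E c N ((StdForm.antidiagonal N).over E) b ∈ borelAdelic F E c N := Subgroup.mem_comap.1 hb
    dsimp only
    rw [dif_pos hb', map_mul, mul_assoc, flatSectionU_borel_mul_of_isChiSection hφ.1 z hb']
  · have hk' : archToAdelic F E c N ((StdForm.antidiagonal N).over E) k ∈ K' := hKinf k (Subgroup.mem_comap.1 (Subgroup.mem_comap.1 hk))
    dsimp only
    rw [dif_pos hk', map_mul, mul_assoc, (commute_archToAdelic_finAdelicToAdelic F E c N _ k xf).eq, ← mul_assoc]
    exact flatSectionU_mul_of_mem_comap hK' hφ z _ ⟨_, hk'⟩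

end Slices

/-! ## §2 The pure tensor `h_∞ ⊗ 𝟙_U` acting on flat sections: Fubini and the archimedean scalar -/

section Scalar

variable [MeasurableSpace (quasiSplit F E c N).Adelic] [BorelSpace (quasiSplit F E c N).Adelic]
variable [MeasurableSpace (arch F E c N ((StdForm.antidiagonal N).over E))] [BorelSpace (arch F E c N ((StdForm.antidiagonal N).over E))]
variable [MeasurableSpace (finAdelic F E c N ((StdForm.antidiagonal N).over E))] [BorelSpace (finAdelic F E c N ((StdForm.antidiagonal N).over E))]
variable (νG : Measure (quasiSplit F E c N).Adelic) [νG.IsHaarMeasure]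
variable (μa : Measure (arch F E c N ((StdForm.antidiagonal N).over E))) [μa.IsHaarMeasure] [μa.IsMulRightInvariant]
variable (μf : Measure (finAdelic F E c N ((StdForm.antidiagonal N).over E))) [μf.IsHaarMeasure]
variable {χ : HeckeCharacter E} {K' : Subgroup (quasiSplit F E c N).Adelic} {ω : ↥K' → ℂ}

include μa μf in
/-- **`∫_G (h_∞ ⊗ 𝟙_U)(y)·f_z^φ(x y) dy = s·f_z^φ(x)` WITH ONE `s` FOR ALL `φ ∈ V(χ,K′,ω)` AND ALL `x`**: `c ≠ 1` fixing the infinite places; `h(y) = h_∞(y_∞)·𝟙_U(y_f)` with `h_∞` `K_∞`-central and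
`ι_f(U) ⊆ K′` acting trivially (`ω = 1` on it); `K′ ≤ K`, `K′ ⊇ ι(K_∞)`; `μ_∞` two-sided Haar on `G_∞`.  Proof: `x = ι(a₀)ι_f(x_f)` (★ `archToAdelic_mul_finAdelicToAdelic`); ★
`exists_integral_eq_smul_integral_adelicProdEquiv` turns `∫_G` into `κ·∫_{G_∞×G_f}`; on `U` the integrand is `h_∞(a)·A(a₀a)·𝟙_U(b)` with `A` the slice of §1 (commuting factors, right
`U`-invariance), so Fubini (`integral_prod_mul`) and 📤 12d-I `exists_rightConv_eq_smul_of_central` (§0 `G_∞ = B_∞K_∞`) give `κ·ĥ_∞·(∫𝟙_U)·A(a₀)`; `s := κ·(∫_{G_f}𝟙_U dμ_f)·ĥ_∞`.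
[cite: BernsteinLapid2019, §4 Claim 1] [cite: BorelJacquet1979, §4.1] [cite: Knapp1986, VII §1] -/
theorem exists_integral_pureTensor_mul_flatSectionU_eq (hc : c ≠ 1) (hfix : ∀ w : InfinitePlace E, c • w = w)
    (hK' : K' ≤ ((standardMaximalCompactGL N E).comap (adelicVal F E c N ((StdForm.antidiagonal N).over E)) : Subgroup (quasiSplit F E c N).Adelic))
    (hKinf : ∀ k : arch F E c N ((StdForm.antidiagonal N).over E),
      adelicVal F E c N ((StdForm.antidiagonal N).over E) (archToAdelic F E c N _ k) ∈ standardMaximalCompactGL N E → archToAdelic F E c N _ k ∈ K')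
    {h : (quasiSplit F E c N).Adelic → ℂ} {hinf : arch F E c N ((StdForm.antidiagonal N).over E) → ℂ} {U : Set (finAdelic F E c N ((StdForm.antidiagonal N).over E))}
    (hten : ∀ y, h y = hinf (archPart F E c N _ y) * U.indicator (fun _ => (1 : ℂ)) (finPart F E c N _ y))
    (hcent : ∀ k ∈ (((standardMaximalCompactGL N E).comap (adelicVal F E c N ((StdForm.antidiagonal N).over E))).comap (archToAdelic F E c N ((StdForm.antidiagonal N).over E))),
      ∀ y, hinf (k⁻¹ * y * k) = hinf y)
    (hU : ∀ b ∈ U, ∃ hb : finAdelicToAdelic F E c N ((StdForm.antidiagonal N).over E) b ∈ K', ω ⟨_, hb⟩ = 1) (z : ℂ) :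
    ∃ s : ℂ, ∀ φ ∈ chiSectionSpace χ K' ω, ∀ x : (quasiSplit F E c N).Adelic,
      ∫ y, h y * flatSectionU φ z (x * y) ∂νG = s * flatSectionU φ z x := by
  letI : MeasurableSpace (adelic F E c N ((StdForm.antidiagonal N).over E)) := ‹MeasurableSpace (quasiSplit F E c N).Adelic›
  haveI : BorelSpace (adelic F E c N ((StdForm.antidiagonal N).over E)) := ⟨‹BorelSpace (quasiSplit F E c N).Adelic›.measurable_eq⟩
  -- the Haar property of `νG` read on the (definitionally equal) subtype structure of `adelic F E c N J_N`
  haveI : @Measure.IsHaarMeasure (↥(adelic F E c N ((StdForm.antidiagonal N).over E))) _ _ _ νG :=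
    { lt_top_of_isCompact := fun K hK => IsFiniteMeasureOnCompacts.lt_top_of_isCompact (μ := νG) hK
      map_mul_left_eq_self := fun g => map_mul_left_eq_self νG g
      open_pos := fun U hU hne => IsOpenPosMeasure.open_pos (μ := νG) U hU hne }
  obtain ⟨κ, -, hκ⟩ := exists_integral_eq_smul_integral_adelicProdEquiv F E c N ((StdForm.antidiagonal N).over E) νG μa μf
  obtain ⟨ĥ, hĥ⟩ := exists_rightConv_eq_smul_of_central
    ((borelAdelic F E c N).comap (archToAdelic F E c N ((StdForm.antidiagonal N).over E)))
    (((standardMaximalCompactGL N E).comap (adelicVal F E c N ((StdForm.antidiagonal N).over E))).comap (archToAdelic F E c N ((StdForm.antidiagonal N).over E)))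
    (fun b => if hb : archToAdelic F E c N ((StdForm.antidiagonal N).over E) b ∈ borelAdelic F E c N then
          ((χ (firstEntryUnit hb) : ℂˣ) : ℂ) * ((((IdeleClassGroup.ideleNorm E (lastEntryUnit hb))⁻¹ : ℝ≥0) : ℝ) : ℂ) ^ z else 0)
    (fun k => if hk : archToAdelic F E c N ((StdForm.antidiagonal N).over E) k ∈ K' then ω ⟨_, hk⟩ else 0)
    μa (exists_mem_comap_borel_mul_mem_comap_K_arch hc hfix) hcent
  refine ⟨(κ : ℂ) * ((∫ b, U.indicator (fun _ => (1 : ℂ)) b ∂μf) * ĥ), fun φ hφ x => ?_⟩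
  -- `x = ι(a₀)·ι_f(x_f)` and the slice at `x_f`
  set a₀ := archPart F E c N ((StdForm.antidiagonal N).over E) x with ha₀
  set xf := finPart F E c N ((StdForm.antidiagonal N).over E) x with hxf
  have hx : x = archToAdelic F E c N _ a₀ * finAdelicToAdelic F E c N _ xf := (archToAdelic_mul_finAdelicToAdelic F E c N _ x).symm
  set A : arch F E c N ((StdForm.antidiagonal N).over E) → ℂ := fun a => flatSectionU φ z (archToAdelic F E c N _ a * finAdelicToAdelic F E c N _ xf) with hA
  obtain ⟨hAB, hAK⟩ := slice_section hK' hKinf hφ z xf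
  have hRA := congrFun (hĥ A hAB hAK) a₀
  simp only [Pi.smul_apply, smul_eq_mul] at hRA
  -- the integrand on `G_∞ × G_f` is `(h_∞(a)·A(a₀ a))·𝟙_U(b)`
  have hint : ∀ p : arch F E c N ((StdForm.antidiagonal N).over E) × finAdelic F E c N ((StdForm.antidiagonal N).over E),
      h (archToAdelic F E c N _ p.1 * finAdelicToAdelic F E c N _ p.2) * flatSectionU φ z (x * (archToAdelic F E c N _ p.1 * finAdelicToAdelic F E c N _ p.2)) =
        (hinf p.1 * A (a₀ * p.1)) * U.indicator (fun _ => (1 : ℂ)) p.2 := by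
    rintro ⟨a, b⟩
    dsimp only
    rw [hten, map_mul, map_mul, archPart_archToAdelic, archPart_finAdelicToAdelic, finPart_archToAdelic, finPart_finAdelicToAdelic, mul_one, one_mul]
    by_cases hb : b ∈ U
    · obtain ⟨hbK, hωb⟩ := hU b hb
      rw [Set.indicator_of_mem hb, hx, hA]
      dsimp only
      rw [map_mul, show archToAdelic F E c N _ a₀ * finAdelicToAdelic F E c N _ xf * (archToAdelic F E c N _ a * finAdelicToAdelic F E c N _ b) =
          archToAdelic F E c N _ a₀ * archToAdelic F E c N _ a * finAdelicToAdelic F E c N _ xf * finAdelicToAdelic F E c N _ b by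
            rw [mul_assoc, ← mul_assoc (finAdelicToAdelic F E c N _ xf), ← (commute_archToAdelic_finAdelicToAdelic F E c N _ a xf).eq]; simp only [mul_assoc],
        flatSectionU_mul_of_mem_comap hK' hφ z _ ⟨_, hbK⟩, hωb]
      ring
    · rw [Set.indicator_of_notMem hb, mul_zero, zero_mul, mul_zero]
  have step1 : ∫ y, h y * flatSectionU φ z (x * y) ∂νG =
      (κ : ℝ) • ∫ p : arch F E c N ((StdForm.antidiagonal N).over E) × finAdelic F E c N ((StdForm.antidiagonal N).over E),
        h (archToAdelic F E c N _ p.1 * finAdelicToAdelic F E c N _ p.2) * flatSectionU φ z (x * (archToAdelic F E c N _ p.1 * finAdelicToAdelic F E c N _ p.2)) ∂(μa.prod μf) :=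
    hκ (fun y : (quasiSplit F E c N).Adelic => h y * flatSectionU φ z (x * y))
  haveI := sFinite_haar_finAdelic F E c N ((StdForm.antidiagonal N).over E) μf
  have step2 : ∫ p : arch F E c N ((StdForm.antidiagonal N).over E) × finAdelic F E c N ((StdForm.antidiagonal N).over E),
      hinf p.1 * A (a₀ * p.1) * U.indicator (fun _ => (1 : ℂ)) p.2 ∂(μa.prod μf) =
        (∫ a, hinf a * A (a₀ * a) ∂μa) * ∫ b, U.indicator (fun _ => (1 : ℂ)) b ∂μf :=
    integral_prod_mul (fun a => hinf a * A (a₀ * a)) (U.indicator fun _ => (1 : ℂ))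
  rw [step1, integral_congr_ae (Filter.Eventually.of_forall hint), step2, hRA, hx]
  simp only [hA, Complex.real_smul]
  ring

/-! ## §3 HEAD: the transported section is a scalar multiple -/

include μa μf in
/-- **ROW 12d-C HEAD — AN ARCHIMEDEAN-ONLY `K_∞`-CENTRAL TEST FUNCTION ACTS ON `V(χ, K′, ω)` BY A SCALAR**: under the hypotheses of §2, there is ONE `s : ℂ` (at the given `z`) with
`T_{h,z}φ = s • φ` for EVERY `φ ∈ chiSectionSpace χ K′ ω`, where `(T_{h,z}φ)(x) = (∫_G h(y)f_z^φ(xy)dy)·H(x)^{−z}` is ★ row 10's transported section (the coercion of `𝔥 z φ` in ★ `exists_heckeEnd`) —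
hence the Hecke MATRIX of `h` on `V` is `𝔥(z) = s(z)·1`, the letter `h𝔥` of ★ 12c `exists_isOpen_forall_not_hasEigenvalue_of_eq_smul`.  NOT proved here (letters for the consumer): the
NON-CONSTANCY of `z ↦ s(z)` (★ 12c's `hnc`; `s` is entire by ★ row 10's third clause wherever some `φ(x) ≠ 0`), and the `C_c` ∕ symmetry ∕ reality of the pure tensor `h` (★ `UnitaryGroupPureTensorContinuity`).
[cite: BernsteinLapid2019, §4 Claim 1] [cite: Knapp1986, VII §1] [cite: BorelJacquet1979, §4.1] -/
theorem exists_rightConvSection_eq_smul_of_arch (hc : c ≠ 1) (hfix : ∀ w : InfinitePlace E, c • w = w)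
    (hK' : K' ≤ ((standardMaximalCompactGL N E).comap (adelicVal F E c N ((StdForm.antidiagonal N).over E)) : Subgroup (quasiSplit F E c N).Adelic))
    (hKinf : ∀ k : arch F E c N ((StdForm.antidiagonal N).over E),
      adelicVal F E c N ((StdForm.antidiagonal N).over E) (archToAdelic F E c N _ k) ∈ standardMaximalCompactGL N E → archToAdelic F E c N _ k ∈ K')
    {h : (quasiSplit F E c N).Adelic → ℂ} {hinf : arch F E c N ((StdForm.antidiagonal N).over E) → ℂ} {U : Set (finAdelic F E c N ((StdForm.antidiagonal N).over E))}
    (hten : ∀ y, h y = hinf (archPart F E c N _ y) * U.indicator (fun _ => (1 : ℂ)) (finPart F E c N _ y))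
    (hcent : ∀ k ∈ (((standardMaximalCompactGL N E).comap (adelicVal F E c N ((StdForm.antidiagonal N).over E))).comap (archToAdelic F E c N ((StdForm.antidiagonal N).over E))),
      ∀ y, hinf (k⁻¹ * y * k) = hinf y)
    (hU : ∀ b ∈ U, ∃ hb : finAdelicToAdelic F E c N ((StdForm.antidiagonal N).over E) b ∈ K', ω ⟨_, hb⟩ = 1) (z : ℂ) :
    ∃ s : ℂ, ∀ φ ∈ chiSectionSpace χ K' ω,
      (fun x => (∫ y, h y * flatSectionU φ z (x * y) ∂νG) * (((borelHeight x : ℝ≥0) : ℝ) : ℂ) ^ (-z)) = s • φ := by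
  obtain ⟨s, hs⟩ := exists_integral_pureTensor_mul_flatSectionU_eq νG μa μf hc hfix hK' hKinf hten hcent hU z
  refine ⟨s, fun φ hφ => funext fun x => ?_⟩
  have hne : (((borelHeight x : ℝ≥0) : ℝ) : ℂ) ≠ 0 := Complex.ofReal_ne_zero.2 (ne_of_gt (by exact_mod_cast borelHeight_pos x))
  rw [hs φ hφ x, Pi.smul_apply, smul_eq_mul, flatSectionU_apply, mul_assoc, mul_assoc, ← Complex.cpow_add _ _ hne, add_neg_cancel, Complex.cpow_zero, mul_one]

end Scalar

end Summit.HodgeConjecture.HodgeConjecture.Cruxes.H413.K2E1ChiHeckeArchScalarU2
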